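import Mathlib.Data.Nat.Choose.Sum
import Mathlib.Logic.Equiv.Fin.Basic
import Literature.Computability.MetaComplexity.RazborovSmolenskyApprox
import HarnessLib

/-!
# Razborov–Smolensky for `G(k)` gates, I: interpolation on a Hamming ball and the gate polynomial

First part of the **Razborov–Smolensky approximation lemma for `GC⁰(k)[p]` circuits**
(Grewal–Kumar 2024, Thm. 3.8: circuits of `G(k)` gates and `MOD_p` gates are approximated by
low-degree `𝔽_p`-polynomials), in the PRODUCT FORM obtained by using Razborov's OR-polynomial
for the threshold "outside the Hamming ball" instead of the sharper probabilistic polynomial of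
Srinivasan–Tripathi–Venkitesh that Grewal–Kumar quote as their Lemma 3.5. This file treats ONE
gate; the circuit-level statement is in `RazborovSmolenskyBallSemantics.lean` /
`RazborovSmolenskyBallApprox.lean`, extending the tree's `Smolensky.razborov_smolensky`
(`RazborovSmolenskyApprox.lean`, basis `{¬, ∧, ∨, MOD_p}`) to the basis `gcBasis k p` of
`Complexity/BallGates.lean`.

A `G(k)` gate with truth table `op`, centre `c` and outside value `b` (constant `b` at Hamming
distance `> k` from `c`; Grewal–Kumar 2024 §2.1) is represented, for trial coefficients
`coef t S ∈ 𝔽_p` (`ℓ` trials, `S` ranging over the `(k+1)`-sets of argument positions), by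

  `P(v) = [b] + (1 - T(v)) · (Q(v) - [b])`,   where

* `Q = ballInterp k op c` is the unique multilinear polynomial of degree `≤ k` in the shifted
  literals `wᵢ = lit (c i) (v i)` (`= vᵢ ⊕ cᵢ` at Boolean points) agreeing with `op` on the ball —
  written down explicitly by MÖBIUS INVERSION on the Boolean lattice (`mobCoeff`,
  `sum_powerset_mobius`, `ballInterp_bit_eq`; Grewal–Kumar 2024, Lemma 3.4, prove existence and
  uniqueness by a nonsingular linear system instead);
* `T = ballThr k ℓ coef c = 1 - Π_{t<ℓ} (1 - L_t^{p-1})`, `L_t = Σ_{|S|=k+1} coef t S · Π_{i∈S} wᵢ`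
  (`ballLin`), is Razborov's randomized polynomial for `OR_{|S|=k+1} w^S = [|w| > k]`
  (Smolensky 1987, Lemma 1).

Proved here: inside the ball `P` is exact for every seed (`ballPoly_bit_eq_of_le`); outside the
ball `P ≠ [b]` forces all `ℓ` linear forms to vanish (`ballLin_eq_zero_of_ballPoly_ne`); and the
degree bound `deg P ≤ ((p-1)ℓ(k+1) + k)·Δ` when the arguments have degree `≤ Δ`
(`ballPoly_fn_mem_lowDeg`, `ballDegree p k ℓ = (p-1)ℓ(k+1) + k`); hence at most a `p^{-ℓ}` fraction
of the trial coefficients err at any Boolean input (`card_ballPoly_ne_mul_le`, via the tree's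
hyperplane count `card_filter_linear_eq_zero_mul`). Sets of argument positions are addressed in
a seed reader through `subsetCode : Finset (Fin m) → ℕ` (`< 2^m`, injective).

Deliberately NOT here: the sharp additive degree `O(k + log(1/ε))` of Grewal–Kumar's Lemma 3.6
(needs [STV] Thm. 18: probabilistic degree `O(√(k log(1/ε)) + log(1/ε))` for `THR^k`) —
TODO(sharp form); the product form loses a factor `min(k+1, ℓ)` per level, irrelevant for
polynomial-size circuits with `ℓ = O(log n)` up to one logarithm.

## References

* S. Grewal, V. M. Kumar, *Improved circuit lower bounds and quantum-classical separations*,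
  arXiv:2408.16406 (2024), §2.1, Lemma 3.4, Lemma 3.6, Thm. 3.8 [GrewalKumar2024].
* R. Smolensky, *Algebraic methods in the theory of lower bounds for Boolean circuit
  complexity*, STOC 1987, Lemma 1 [Smolensky1987].
-/

noncomputable section

namespace Literature.Computability.MetaComplexity

open Finset Literature.Computability.Complexity Literature.Computability.Complexity.GateList

namespace Smolensky

/-! ### Möbius inversion on the Boolean lattice (over a commutative ring) -/

section Mobius

variable {α R : Type*} [DecidableEq α] [CommRing R]

/-- `Σ_{W ⊆ D} (-1)^{|W|} = [D = ∅]` in any commutative ring. [folklore] -/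
private theorem sum_powerset_neg_one_pow_card_cast (D : Finset α) :
    ∑ W ∈ D.powerset, (-1 : R) ^ W.card = if D = ∅ then 1 else 0 := by
  have h := Finset.sum_powerset_neg_one_pow_card (x := D)
  have h' := congrArg (fun z : ℤ => (z : R)) h
  simp only [Int.cast_sum, Int.cast_pow, Int.cast_neg, Int.cast_one] at h'
  rw [h']; split_ifs <;> simp

/-- **Möbius inversion on the Boolean lattice** (`(F⁻)⁺ = F`): for every set function `g`,
`Σ_{S ⊆ U} Σ_{T ⊆ S} (-1)^{|S ∖ T|} g(T) = g(U)`. [folklore] -/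
private theorem sum_powerset_mobius (g : Finset α → R) (U : Finset α) :
    ∑ S ∈ U.powerset, ∑ T ∈ S.powerset, (-1 : R) ^ (S \ T).card * g T = g U := by
  rw [Finset.sum_comm' (t' := U.powerset) (s' := fun T => U.powerset.filter (fun S => T ⊆ S))]
  · have : ∀ T ∈ U.powerset, ∑ S ∈ U.powerset.filter (fun S => T ⊆ S), (-1 : R) ^ (S \ T).card * g T
        = (if T = U then 1 else 0) * g T := by
      intro T hT
      rw [← sum_mul]
      congr 1
      have key : ∑ S ∈ U.powerset.filter (fun S => T ⊆ S), (-1 : R) ^ (S \ T).card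
          = ∑ W ∈ (U \ T).powerset, (-1 : R) ^ W.card := by
        refine Finset.sum_nbij' (fun S => S \ T) (fun W => T ∪ W) ?_ ?_ ?_ ?_ ?_
        · intro S hS
          simp only [mem_filter, mem_powerset] at hS
          exact mem_powerset.2 (sdiff_subset_sdiff hS.1 le_rfl)
        · intro W hW
          rw [mem_powerset] at hW
          simp only [mem_filter, mem_powerset]
          exact ⟨union_subset (mem_powerset.1 hT) (hW.trans sdiff_subset), subset_union_left⟩
        · intro S hS
          simp only [mem_filter, mem_powerset] at hS
          exact union_sdiff_of_subset hS.2
        · intro W hW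
          rw [mem_powerset] at hW
          rw [Finset.union_sdiff_left, Finset.sdiff_eq_self_iff_disjoint]
          exact Finset.sdiff_disjoint.mono_left hW
        · intro S _; rfl
      rw [key, sum_powerset_neg_one_pow_card_cast]
      by_cases h : T = U
      · subst h; simp
      · rw [if_neg, if_neg h]
        intro hUT; apply h
        exact Subset.antisymm (mem_powerset.1 hT) (sdiff_eq_empty_iff_subset.1 hUT)
    rw [sum_congr rfl this]
    simp_rw [boole_mul]
    rw [Finset.sum_ite_eq', if_pos (mem_powerset.2 (subset_refl U))]
  · intro S T
    simp only [mem_powerset, mem_filter]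
    constructor
    · rintro ⟨hSU, hTS⟩; exact ⟨⟨hSU, hTS⟩, hTS.trans hSU⟩
    · rintro ⟨⟨hSU, hTS⟩, _⟩; exact ⟨hSU, hTS⟩

end Mobius

/-! ### Interpolating a truth table on a Hamming ball (Grewal–Kumar 2024, Lemma 3.4) -/

section Ball

variable {p : ℕ} [Fact p.Prime] {m : ℕ}

/-- The point `c ⊕ 1_T` of the cube: flip the coordinates of `c` in `T`. [folklore] -/
def flipOn (c : Fin m → Bool) (T : Finset (Fin m)) : Fin m → Bool :=
  fun i => if i ∈ T then !c i else c i

/-- Flipping `c` exactly on the coordinates where `v` differs from `c` gives `v`. [folklore] -/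
private theorem flipOn_filter_ne (c v : Fin m → Bool) :
    flipOn c (univ.filter fun i => v i ≠ c i) = v := by
  funext i
  unfold flipOn
  by_cases h : v i = c i
  · rw [if_neg (by simp [h]), h]
  · rw [if_pos (by simp [h])]
    cases hv : v i <;> cases hc : c i <;> simp_all

/-- A shifted literal: `lit b x = x` if `b = 0` and `1 - x` if `b = 1`, so that at a Boolean point
`lit (c i) [v i] = [v i ≠ c i]`. [folklore] -/
def lit (b : Bool) (x : ZMod p) : ZMod p := if b then 1 - x else x

/-- At Boolean points the shifted literal is the indicator of disagreement with the centre.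
[folklore] -/
private theorem lit_bit (b v : Bool) : lit b (bit p v) = if v ≠ b then 1 else 0 := by
  cases b <;> cases v <;> simp [lit, bit]

/-- A product of shifted literals at a Boolean point is the indicator that `v` differs from `c`
on all of `S`. [folklore] -/
private theorem prod_lit_bit (c v : Fin m → Bool) (S : Finset (Fin m)) :
    ∏ i ∈ S, lit (c i) (bit p (v i)) = if ∀ i ∈ S, v i ≠ c i then 1 else 0 := by
  simp_rw [lit_bit]
  rw [Finset.prod_boole]
  congr 1

/-- The Möbius coefficient of the monomial `S` for the truth table `op` re-centred at `c`:
`a_S = Σ_{T ⊆ S} (-1)^{|S ∖ T|} [op (c ⊕ 1_T)]`. [cite: GrewalKumar2024, Lemma 3.4] -/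
def mobCoeff (op : (Fin m → Bool) → Bool) (c : Fin m → Bool) (S : Finset (Fin m)) : ZMod p :=
  ∑ T ∈ S.powerset, (-1 : ZMod p) ^ (S \ T).card * bit p (op (flipOn c T))

/-- **The ball interpolant** of the truth table `op` around the centre `c`, radius `k`, as a
polynomial expression of degree `≤ k` in ring-valued arguments:
`Q(v) = Σ_{|S| ≤ k} a_S Π_{i ∈ S} lit (c i) (v i)`. [cite: GrewalKumar2024, Lemma 3.4] -/
def ballInterp (k : ℕ) (op : (Fin m → Bool) → Bool) (c : Fin m → Bool) (v : Fin m → ZMod p) :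
    ZMod p :=
  ∑ S ∈ (univ : Finset (Fin m)).powerset.filter (fun S => S.card ≤ k),
    mobCoeff op c S * ∏ i ∈ S, lit (c i) (v i)

/-- **Interpolation on a Hamming ball** (Grewal–Kumar 2024, Lemma 3.4, existence half, by
Möbius inversion instead of linear algebra): at every Boolean point `v` within Hamming distance
`k` of the centre `c`, the degree-`≤ k` expression `ballInterp k op c` takes the value `[op v]`.
[cite: GrewalKumar2024, Lemma 3.4] -/
theorem ballInterp_bit_eq (k : ℕ) (op : (Fin m → Bool) → Bool) (c v : Fin m → Bool)
    (hv : (univ.filter fun i => v i ≠ c i).card ≤ k) :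
    ballInterp k op c (fun i => bit p (v i)) = bit p (op v) := by
  set U : Finset (Fin m) := univ.filter fun i => v i ≠ c i with hU
  unfold ballInterp
  simp_rw [prod_lit_bit, mul_ite, mul_one, mul_zero]
  -- only the monomials `S ⊆ U` survive, and all of them have `|S| ≤ k`
  have hsupp : ∀ S : Finset (Fin m), (∀ i ∈ S, v i ≠ c i) ↔ S ⊆ U := by
    intro S
    simp only [hU, Finset.subset_iff, mem_filter, mem_univ, true_and]
  rw [← Finset.sum_filter]
  have hfilt : ((univ : Finset (Fin m)).powerset.filter (fun S => S.card ≤ k)).filter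
      (fun S => ∀ i ∈ S, v i ≠ c i) = U.powerset := by
    ext S
    simp only [mem_filter, mem_powerset, subset_univ, true_and, hsupp]
    constructor
    · exact fun h => h.2
    · exact fun h => ⟨(card_le_card h).trans hv, h⟩
  rw [hfilt]
  unfold mobCoeff
  rw [sum_powerset_mobius (fun T => bit p (op (flipOn c T))) U, hU, flipOn_filter_ne]

/-! ### Coding sets of argument positions by numbers -/

/-- A code of a set of argument positions of an `m`-ary gate as a number `< 2^m` (via
`Fintype.equivFin`); used to address the trial coefficient of a `(k+1)`-subset in a seed
reader. [folklore] -/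
def subsetCode (S : Finset (Fin m)) : ℕ := (Fintype.equivFin (Finset (Fin m)) S : ℕ)

/-- Codes are `< 2^m`. [folklore] -/
private theorem subsetCode_lt (S : Finset (Fin m)) : subsetCode S < 2 ^ m := by
  have h := (Fintype.equivFin (Finset (Fin m)) S).isLt
  simpa [subsetCode, Fintype.card_finset, Fintype.card_fin] using h

/-- Coding is injective. [folklore] -/
private theorem subsetCode_injective : Function.Injective (subsetCode (m := m)) := by
  intro S T h
  exact (Fintype.equivFin (Finset (Fin m))).injective (Fin.ext h)

/-! ### The polynomial of a `G(k)` gate (Grewal–Kumar 2024, Lemma 3.6, product form) -/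

/-- The linear form of trial `t` over the `(k+1)`-monomials in the shifted literals:
`L_t(v) = Σ_{|S| = k+1} c_{t,S} Π_{i ∈ S} lit (c i) (v i)` (Razborov's random linear
combination testing "`v` is outside the ball"). [cite: Smolensky1987, Lemma 1] -/
def ballLin (k : ℕ) (coef : ℕ → ℕ → ZMod p) (c : Fin m → Bool) (t : ℕ) (v : Fin m → ZMod p) :
    ZMod p :=
  ∑ S ∈ powersetCard (k + 1) (univ : Finset (Fin m)), coef t (subsetCode S) * ∏ i ∈ S, lit (c i) (v i)

/-- The probabilistic polynomial for the threshold "`v` is outside the ball of radius `k`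
around `c`": `T(v) = 1 - Π_{t<ℓ} (1 - L_t(v)^{p-1})` (Razborov's OR-approximation of
`OR_{|S|=k+1} Π_{i∈S} [v i ≠ c i]`). [cite: Smolensky1987, Lemma 1] -/
def ballThr (k ℓ : ℕ) (coef : ℕ → ℕ → ZMod p) (c : Fin m → Bool) (v : Fin m → ZMod p) : ZMod p :=
  1 - ∏ t ∈ range ℓ, (1 - ballLin k coef c t v ^ (p - 1))

/-- **The polynomial of a `G(k)` gate** with truth table `op`, centre `c`, outside value `b`:
`P(v) = [b] + (1 - T(v)) · (Q(v) - [b])` with `Q` the ball interpolant and `T` the randomized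
outside-the-ball test (Grewal–Kumar 2024, proof of Lemma 3.6, with Razborov's OR-polynomial for
`THR^k` in place of the sharper [STV] polynomial). [cite: GrewalKumar2024, Lemma 3.6] -/
def ballPoly (k ℓ : ℕ) (coef : ℕ → ℕ → ZMod p) (op : (Fin m → Bool) → Bool) (c : Fin m → Bool)
    (b : Bool) (v : Fin m → ZMod p) : ZMod p :=
  bit p b + (1 - ballThr k ℓ coef c v) * (ballInterp k op c v - bit p b)

/-- Inside the ball every `(k+1)`-monomial vanishes at a Boolean point, so every linear form
`L_t` vanishes. [cite: Smolensky1987, Lemma 1] -/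
theorem ballLin_bit_eq_zero (k : ℕ) (coef : ℕ → ℕ → ZMod p) (c v : Fin m → Bool)
    (hv : (univ.filter fun i => v i ≠ c i).card ≤ k) (t : ℕ) :
    ballLin k coef c t (fun i => bit p (v i)) = 0 := by
  unfold ballLin
  refine Finset.sum_eq_zero fun S hS => ?_
  rw [prod_lit_bit, if_neg, mul_zero]
  intro hall
  have hsub : S ⊆ univ.filter fun i => v i ≠ c i := fun i hi => by simpa using hall i hi
  have hcard := (mem_powersetCard.1 hS).2
  have := card_le_card hsub
  omega

/-- **Inside the ball the gate polynomial is exact** (no error, for every seed).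
[cite: GrewalKumar2024, Lemma 3.6] -/
theorem ballPoly_bit_eq_of_le (k ℓ : ℕ) (coef : ℕ → ℕ → ZMod p) (op : (Fin m → Bool) → Bool)
    (c v : Fin m → Bool) (b : Bool) (hv : (univ.filter fun i => v i ≠ c i).card ≤ k) :
    ballPoly k ℓ coef op c b (fun i => bit p (v i)) = bit p (op v) := by
  have hp := (Fact.out : p.Prime)
  unfold ballPoly ballThr
  simp_rw [ballLin_bit_eq_zero k coef c v hv]
  rw [zero_pow (Nat.sub_ne_zero_of_lt hp.one_lt), sub_zero, Finset.prod_const_one, sub_self,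
    sub_zero, one_mul, ballInterp_bit_eq k op c v hv]
  ring

/-- **Outside the ball the gate polynomial errs only if all `ℓ` linear forms vanish**: if
`dist(v,c) > k`, the gate's value is the outside constant `b`, and `P(v) ≠ [b]` forces
`L_t(v) = 0` for all `t < ℓ`. [cite: Smolensky1987, Lemma 1] -/
theorem ballLin_eq_zero_of_ballPoly_ne (k ℓ : ℕ) (coef : ℕ → ℕ → ZMod p)
    (op : (Fin m → Bool) → Bool) (c v : Fin m → Bool) (b : Bool)
    (hne : ballPoly k ℓ coef op c b (fun i => bit p (v i)) ≠ bit p b) :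
    ∀ t ∈ range ℓ, ballLin k coef c t (fun i => bit p (v i)) = 0 := by
  intro t ht
  by_contra hL
  apply hne
  unfold ballPoly ballThr
  rw [Finset.prod_eq_zero ht (by rw [ZMod.pow_card_sub_one_eq_one hL, sub_self]), sub_zero,
    sub_self, zero_mul, add_zero]

/-! ### Degree of the ball-gate polynomial -/

variable {n : ℕ}

/-- Constants have degree `0`. [folklore] -/
private theorem const_mem_lowDeg (a : ZMod p) (D : ℕ) : (fun _ => a : CubeFn (ZMod p) n) ∈ lowDeg (ZMod p) n D := by
  have e : (fun _ => a : CubeFn (ZMod p) n) = a • (1 : CubeFn (ZMod p) n) := by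
    funext x; simp
  rw [e]
  exact Submodule.smul_mem _ _ (one_mem_lowDeg D)

/-- A shifted literal of a degree-`≤ Δ` function has degree `≤ Δ`. [folklore] -/
private theorem lit_fn_mem_lowDeg (b : Bool) {Δ : ℕ} {W : CubeFn (ZMod p) n} (hW : W ∈ lowDeg (ZMod p) n Δ) :
    (fun x => lit b (W x)) ∈ lowDeg (ZMod p) n Δ := by
  cases b
  · have e : (fun x => lit false (W x)) = W := by funext x; simp [lit]
    rw [e]; exact hW
  · have e : (fun x => lit true (W x)) = 1 - W := by funext x; simp [lit]
    rw [e]; exact Submodule.sub_mem _ (one_mem_lowDeg Δ) hW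

/-- A product of `|S|` shifted literals of degree-`≤ Δ` functions has degree `≤ |S|·Δ`.
[folklore] -/
private theorem prod_lit_fn_mem_lowDeg (c : Fin m → Bool) (S : Finset (Fin m)) {Δ : ℕ}
    (W : Fin m → CubeFn (ZMod p) n) (hW : ∀ a, W a ∈ lowDeg (ZMod p) n Δ) :
    (fun x => ∏ i ∈ S, lit (c i) (W i x)) ∈ lowDeg (ZMod p) n (S.card * Δ) := by
  have e : (fun x => ∏ i ∈ S, lit (c i) (W i x)) = ∏ i ∈ S, (fun x => lit (c i) (W i x)) := by
    funext x; simp [Finset.prod_apply]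
  rw [e]
  exact prod_mem_lowDeg S fun i _ => lit_fn_mem_lowDeg (c i) (hW i)

/-- **The ball interpolant has degree `≤ k`** in its arguments: substituting degree-`≤ Δ`
functions gives degree `≤ k·Δ`. [cite: GrewalKumar2024, Lemma 3.4] -/
theorem ballInterp_fn_mem_lowDeg (k : ℕ) (op : (Fin m → Bool) → Bool) (c : Fin m → Bool)
    {Δ : ℕ} (W : Fin m → CubeFn (ZMod p) n) (hW : ∀ a, W a ∈ lowDeg (ZMod p) n Δ) :
    (fun x => ballInterp k op c fun a => W a x) ∈ lowDeg (ZMod p) n (k * Δ) := by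
  have e : (fun x => ballInterp k op c fun a => W a x) =
      ∑ S ∈ (univ : Finset (Fin m)).powerset.filter (fun S => S.card ≤ k),
        (mobCoeff op c S : ZMod p) • (fun x => ∏ i ∈ S, lit (c i) (W i x)) := by
    funext x; simp [ballInterp, Finset.sum_apply]
  rw [e]
  refine Submodule.sum_mem _ fun S hS => Submodule.smul_mem _ _ ?_
  have hk : S.card ≤ k := (mem_filter.1 hS).2
  exact lowDeg_mono (Nat.mul_le_mul_right _ hk) (prod_lit_fn_mem_lowDeg c S W hW)

/-- The linear forms `L_t` have degree `≤ (k+1)·Δ`. [cite: Smolensky1987, Lemma 1] -/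
theorem ballLin_fn_mem_lowDeg (k : ℕ) (coef : ℕ → ℕ → ZMod p) (c : Fin m → Bool) (t : ℕ)
    {Δ : ℕ} (W : Fin m → CubeFn (ZMod p) n) (hW : ∀ a, W a ∈ lowDeg (ZMod p) n Δ) :
    (fun x => ballLin k coef c t fun a => W a x) ∈ lowDeg (ZMod p) n ((k + 1) * Δ) := by
  have e : (fun x => ballLin k coef c t fun a => W a x) =
      ∑ S ∈ powersetCard (k + 1) (univ : Finset (Fin m)),
        coef t (subsetCode S) • (fun x => ∏ i ∈ S, lit (c i) (W i x)) := by
    funext x; simp [ballLin, Finset.sum_apply]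
  rw [e]
  refine Submodule.sum_mem _ fun S hS => Submodule.smul_mem _ _ ?_
  rw [← (mem_powersetCard.1 hS).2]
  exact prod_lit_fn_mem_lowDeg c S W hW

/-- The outside-the-ball test has degree `≤ ℓ(p-1)(k+1)·Δ`. [cite: Smolensky1987, Lemma 1] -/
theorem one_sub_ballThr_fn_mem_lowDeg (k ℓ : ℕ) (coef : ℕ → ℕ → ZMod p) (c : Fin m → Bool)
    {Δ : ℕ} (W : Fin m → CubeFn (ZMod p) n) (hW : ∀ a, W a ∈ lowDeg (ZMod p) n Δ) :
    (fun x => 1 - ballThr k ℓ coef c fun a => W a x) ∈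
      lowDeg (ZMod p) n (ℓ * ((p - 1) * ((k + 1) * Δ))) := by
  have e : (fun x => 1 - ballThr k ℓ coef c fun a => W a x) =
      ∏ t ∈ range ℓ, (1 - (fun x => ballLin k coef c t fun a => W a x) ^ (p - 1)) := by
    funext x; simp [ballThr, Finset.prod_apply]
  rw [e]
  have h := prod_mem_lowDeg (range ℓ)
    (u := fun t => 1 - (fun x => ballLin k coef c t fun a => W a x) ^ (p - 1))
    (D := (p - 1) * ((k + 1) * Δ)) fun t _ =>
      Submodule.sub_mem _ (one_mem_lowDeg _) (pow_mem_lowDeg (ballLin_fn_mem_lowDeg k coef c t W hW) _)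
  rwa [Finset.card_range] at h

/-- The degree multiplier of one level of a `GC⁰(k)[p]` circuit in the product-form
Razborov–Smolensky lemma: `M = (p-1)·ℓ·(k+1) + k`. [cite: GrewalKumar2024, Lemma 3.6] -/
def ballDegree (p k ℓ : ℕ) : ℕ := (p - 1) * ℓ * (k + 1) + k

/-- **Degree of the ball-gate polynomial** (Grewal–Kumar 2024, Lemma 3.6, product form):
substituting degree-`≤ Δ` functions for the arguments gives degree `≤ ((p-1)ℓ(k+1) + k)·Δ`.
[cite: GrewalKumar2024, Lemma 3.6] -/
theorem ballPoly_fn_mem_lowDeg (k ℓ : ℕ) (coef : ℕ → ℕ → ZMod p) (op : (Fin m → Bool) → Bool)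
    (c : Fin m → Bool) (b : Bool) {Δ : ℕ} (W : Fin m → CubeFn (ZMod p) n)
    (hW : ∀ a, W a ∈ lowDeg (ZMod p) n Δ) :
    (fun x => ballPoly k ℓ coef op c b fun a => W a x) ∈ lowDeg (ZMod p) n (ballDegree p k ℓ * Δ) := by
  have e : (fun x => ballPoly k ℓ coef op c b fun a => W a x) =
      (fun _ => bit p b) + (fun x => 1 - ballThr k ℓ coef c fun a => W a x) *
        ((fun x => ballInterp k op c fun a => W a x) - fun _ => bit p b) := by
    funext x; simp [ballPoly]
  rw [e]
  refine Submodule.add_mem _ (const_mem_lowDeg _ _) ?_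
  have hdeg : ℓ * ((p - 1) * ((k + 1) * Δ)) + k * Δ = ballDegree p k ℓ * Δ := by
    unfold ballDegree; ring
  rw [← hdeg]
  exact mul_mem_lowDeg_add (one_sub_ballThr_fn_mem_lowDeg k ℓ coef c W hW)
    (Submodule.sub_mem _ (ballInterp_fn_mem_lowDeg k op c W hW) (const_mem_lowDeg _ _))

/-! ### Counting the erring seeds of one `G(k)` gate -/

/-- In range a local seed reader reads the coefficient (positions given as numbers).
[folklore] -/
private theorem lreader_apply_of_lt {ℓ A : ℕ} (cf : Fin ℓ → Fin A → ZMod p) (t : Fin ℓ) {a : ℕ}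
    (ha : a < A) : lreader cf t a = cf t ⟨a, ha⟩ := by
  simp [lreader, t.isLt, ha]

/-- **At most a `p^{-ℓ}` fraction of the local seeds err at a `G(k)` gate** (Smolensky 1987,
Lemma 1, for the outside-the-ball OR over the `(k+1)`-monomials; Grewal–Kumar 2024, Lemma 3.6):
for a truth table `op` that is constantly `b` outside the ball of radius `k` around `c`, at every
Boolean input `v` the trial coefficients `cf : Fin ℓ → Fin A → 𝔽_p` (`A ≥ 2^m` addresses all
sets of positions) for which `P(v) ≠ [op v]` number at most `p^{-ℓ} · #seeds`.
[cite: Smolensky1987, Lemma 1] -/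
theorem card_ballPoly_ne_mul_le (k ℓ A : ℕ) (op : (Fin m → Bool) → Bool) (c : Fin m → Bool)
    (b : Bool) (hop : ∀ v : Fin m → Bool, k < (univ.filter fun i => v i ≠ c i).card → op v = b)
    (hA : 2 ^ m ≤ A) (v : Fin m → Bool) :
    (univ.filter fun cf : Fin ℓ → Fin A → ZMod p =>
        ballPoly k ℓ (lreader cf) op c b (fun i => bit p (v i)) ≠ bit p (op v)).card * p ^ ℓ ≤
      Fintype.card (Fin ℓ → Fin A → ZMod p) := by
  classical
  set U : Finset (Fin m) := univ.filter fun i => v i ≠ c i with hU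
  by_cases hv : U.card ≤ k
  · -- inside the ball: no seed errs
    rw [Finset.filter_eq_empty_iff.2 fun cf _ => by
      rw [not_ne_iff]; exact ballPoly_bit_eq_of_le k ℓ (lreader cf) op c v b hv,
      Finset.card_empty, zero_mul]
    exact Nat.zero_le _
  -- outside the ball: `op v = b`, and an error forces all linear forms to vanish
  have hkU : k < U.card := lt_of_not_ge hv
  have hopv : op v = b := hop v hkU
  obtain ⟨S₀, hS₀U, hS₀card⟩ := Finset.exists_subset_card_eq (Nat.succ_le_of_lt hkU)
  set 𝒮 : Finset (Finset (Fin m)) := powersetCard (k + 1) univ with h𝒮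
  have hS₀ : S₀ ∈ 𝒮 := mem_powersetCard.2 ⟨subset_univ _, hS₀card⟩
  set σ := 𝒮.equivFin with hσ
  set K := 𝒮.card with hK
  -- addresses of the `(k+1)`-sets in the local seed, and the monomial values as weights
  let e : Fin K → Fin A := fun a => ⟨subsetCode (σ.symm a).1, lt_of_lt_of_le (subsetCode_lt _) hA⟩
  have he : Function.Injective e := by
    intro a a' h
    have h1 : subsetCode (σ.symm a).1 = subsetCode (σ.symm a').1 := by
      simpa [e] using congrArg Fin.val h
    exact σ.symm.injective (Subtype.ext (subsetCode_injective h1))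
  let w : Fin K → ZMod p := fun a => ∏ i ∈ (σ.symm a).1, lit (c i) (bit p (v i))
  have hw₀ : w (σ ⟨S₀, hS₀⟩) ≠ 0 := by
    simp only [w, Equiv.symm_apply_apply]
    rw [prod_lit_bit, if_pos fun i hi => by simpa [hU] using hS₀U hi]
    exact one_ne_zero
  -- the linear form of trial `t` in seed coordinates
  have hlin : ∀ (cf : Fin ℓ → Fin A → ZMod p) (t : Fin ℓ),
      ballLin k (lreader cf) c t (fun i => bit p (v i)) = ∑ a, cf t (e a) * w a := by
    intro cf t
    unfold ballLin
    rw [← Finset.sum_coe_sort 𝒮, ← Equiv.sum_comp σ.symm]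
    refine Finset.sum_congr rfl fun a _ => ?_
    rw [lreader_apply_of_lt cf t (lt_of_lt_of_le (subsetCode_lt _) hA)]
  -- the vanishing set of one trial, a hyperplane
  set H : Finset (Fin A → ZMod p) := univ.filter fun c' => (∑ a, c' (e a) * w a) = 0 with hH
  have hHcard : H.card * p = p ^ A :=
    card_filter_linear_eq_zero_mul e he w (σ ⟨S₀, hS₀⟩) hw₀
  have hsub : (univ.filter fun cf : Fin ℓ → Fin A → ZMod p =>
      ballPoly k ℓ (lreader cf) op c b (fun i => bit p (v i)) ≠ bit p (op v)) ⊆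
      univ.filter fun cf : Fin ℓ → Fin A → ZMod p => ∀ t, cf t ∈ H := by
    intro cf hcf
    simp only [Finset.mem_filter, Finset.mem_univ, true_and] at hcf ⊢
    intro t
    rw [hopv] at hcf
    have h0 := ballLin_eq_zero_of_ballPoly_ne k ℓ (lreader cf) op c v b hcf t (mem_range.2 t.isLt)
    rw [hlin cf t] at h0
    simpa [hH] using h0
  calc (univ.filter fun cf : Fin ℓ → Fin A → ZMod p =>
          ballPoly k ℓ (lreader cf) op c b (fun i => bit p (v i)) ≠ bit p (op v)).card * p ^ ℓ
      ≤ (univ.filter fun cf : Fin ℓ → Fin A → ZMod p => ∀ t, cf t ∈ H).card * p ^ ℓ :=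
        Nat.mul_le_mul_right _ (Finset.card_le_card hsub)
    _ = (H.card * p) ^ ℓ := by rw [card_filter_forall_mem, mul_pow]
    _ = Fintype.card (Fin ℓ → Fin A → ZMod p) := by
        rw [hHcard, Fintype.card_fun, Fintype.card_fun, ZMod.card, Fintype.card_fin,
          Fintype.card_fin]

end Ball

end Smolensky

end Literature.Computability.MetaComplexity
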